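import Summits.QuantumFields.YangMills.Theorems.FiniteRankMirrorRungFloor
import Summits.QuantumFields.YangMills.Theorems.SelfNormalisedSkewness.Negative.SelfNormalisedSkewnessFalseOfMaxwellDominatedWindowScheme

/-!
# BC5 rung (T3 witness) for `FiniteRankMirror.X₁ = FiniteRankMirrorFloor`, banked 3/3:
# the separating witness — X₁'s block TRUE and S's clause (ii) FALSE in the free abelian model;
# and why a forced `J ≥ 2` instance is not exhibitable

Tribunal-w seat `ym-mirror-bc5w-1` (g4, 2026-08-28), `--supports stmt-QuantumFields-25679` (route
`route-QuantumFields-FiniteRankMirror`); importable port of §8–§9 of the crux work file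
`Cruxes/FiniteRankMirrorFloor/Lines/rung_lattice.lean` (g3, commit 67076f913b1c).

**The witness of weakness, citable by name** (`latticeRung_separates`): in the abelian lattice gauge theory of
`ℤ⁴` at Gaussian coupling (`μM = curvatureGaussianField 4 1`, an honest probability measure) X₁'s
`∃ J p κ …` block holds with `J = 1`, `p = 0` (`latticeMaxwell_finiteRankMirrorFloor`, file 2/3), while the
clause (ii) three-point floor of S = `BalabanLadder.NT` admits NO `ε > 0` in the free Maxwell continuum limit of
the same model (`freeAbelian_NT_clauseII_false`: the connected three-point functional of the plaquette energy
is `8·maxwellRing3 ≡ 0`, tree `maxwellRing3_eq_zero`).  So the model decides C's analogue TRUE where S's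
analogue is FALSE: the deciding crux is strictly weaker than the summit in a decided model, which is what T3 asks.

**(β) forced `J ≥ 2`** (`exists_mode_of_sum_floor`, `single_mode_of_stable_index`): at each `(a, L)` a
`J`-mode floor `κ ≤ ∑_j m_j` contains ONE mode carrying `κ/J`; a family can therefore force `J ≥ 2` only if the
index of that mode keeps rotating as `a → 0`, i.e. only if the single-mode mirror functionals fail to converge
while their sum stays `≥ κ` — impossible in this (convergent, free) model and in any model with a scaling
limit of `MF`.  Recorded as a theorem about the block's shape, not claimed as a second instance.

NOTHING HERE PROVES the Yang–Mills mass gap, `BalabanLadder.NT`, `FiniteRankMirrorFloor` itself (compact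
SIMPLE `G`, Wilson's measure) or any item of the route: a T3 witness of weakness only.
-/

open MeasureTheory ProbabilityTheory Filter
open scoped Real NNReal ENNReal Topology

noncomputable section

namespace Summit.QuantumFields.YangMills.Theorems.FiniteRankMirror.Rung

open Literature.Probability.LatticeModels Literature.MathematicalPhysics.QuantumLattice
  Literature.MathematicalPhysics.QuantumFieldTheory
open Summit.QuantumFields.YangMills.Theorems.StaticSourceWitness.Rung (Cfg μM densA)

/-! ## §1 (β): a `J`-mode floor always contains a single mode carrying `κ/J` -/

/-- **Pigeonhole for modes**: at each `(a, L)`, a `J`-mode floor `κ ≤ ∑_j m_j` contains one mode with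
`κ/J ≤ m_j`.  Hence a family can force `J ≥ 2` only if the index of that mode does not stabilise as
`a → 0`. [this route] -/
theorem exists_mode_of_sum_floor {J : ℕ} (hJ : 0 < J) (m : Fin J → ℝ) {κ : ℝ} (h : κ ≤ ∑ j, m j) :
    ∃ j, κ / J ≤ m j := by
  have hne : (Finset.univ : Finset (Fin J)).Nonempty := Finset.univ_nonempty_iff.2 ⟨⟨0, hJ⟩⟩
  have hJ' : (J : ℝ) ≠ 0 := by exact_mod_cast hJ.ne'
  have hs : ∑ _j : Fin J, κ / J = κ := by
    rw [Finset.sum_const, Finset.card_univ, Fintype.card_fin, nsmul_eq_mul]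
    field_simp
  obtain ⟨j, _, hj⟩ := Finset.exists_le_of_sum_le hne (f := fun _ => κ / J) (g := m) (by rw [hs]; exact h)
  exact ⟨j, hj⟩

/-- … and if the SAME mode `j` carries `κ/J` along the whole family, the floor already holds with `J = 1`
(and `κ/J`): the `∃ (modes per scale)` shape of X₁ cannot force `J ≥ 2` without index rotation. [this route] -/
theorem single_mode_of_stable_index {ι : Type*} {J : ℕ} (m : ι → Fin J → ℝ) {κ : ℝ} (j : Fin J)
    (h : ∀ i, κ / J ≤ m i j) : ∀ i, κ / J ≤ ∑ j' : Fin 1, m i ((fun _ => j) j') := by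
  intro i
  rw [Fin.sum_univ_one]
  exact h i

/-! ## §2 Separation: S's clause (ii) is FALSE in the free abelian model, X₁'s block is TRUE -/

open scoped SchwartzMap in
open Summit.QuantumFields.YangMills.Theorems.SelfNormalisedSkewness.Negative in
/-- In the free Maxwell₄ model (tree `maxwellKernel`; the continuum limit of `μM`) the connected three-point
functional of the plaquette energy `F²` is `8·maxwellRing3 ≡ 0` (`maxwellRing3_eq_zero`), so NT's clause
(ii) floor admits no `ε > 0`: S's analogue is decided FALSE where X₁'s block is decided TRUE. [this route] -/
theorem freeAbelian_NT_clauseII_false :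
    ¬ ∃ (f g h : 𝓢(E4, ℝ)) (ε : ℝ), 0 < ε ∧ ε ≤ |8 * maxwellRing3 f g h| := by
  rintro ⟨f, g, h, ε, hε, hle⟩
  rw [maxwellRing3_eq_zero] at hle
  norm_num at hle
  linarith

open scoped SchwartzMap in
open Summit.QuantumFields.YangMills.Theorems.SelfNormalisedSkewness.Negative in
/-- **The lattice rung separates C = X₁ from S = NT** (the BC5 / T3 witness of weakness for
`FiniteRankMirror.FiniteRankMirrorFloor`, item `stmt-QuantumFields-25679`): X₁'s block holds in the abelian
lattice gauge theory at Gaussian coupling (honest measure `μM`, `J = 1`, `p = 0`, block written out symbol for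
symbol under `torusE ↦ ∫·dμM`, `dens ↦ densA`, `cfgReflect ↦ cfgReflA`, `a β ↦ a`) AND NT's clause (ii) fails
in its free continuum limit.  It does NOT prove X₁, NT or the Yang–Mills mass gap. [this route] -/
theorem latticeRung_separates :
    (∃ (J : ℕ) (p κ : ℝ), p < 8 ∧ 0 < κ ∧ ∀ ℓ₁ : ℝ, 0 < ℓ₁ →
      ∃ (ℓ : ℝ) (v : Fin J → SchwartzMap (EuclideanSpace ℝ (Fin 4)) ℝ) (a₀ Λ₅ : ℝ), 0 < ℓ ∧ ℓ < ℓ₁ ∧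
        (∀ j, tsupport (v j : EuclideanSpace ℝ (Fin 4) → ℝ) ⊆ {y | 0 < y 0} ∧
          tsupport (v j : EuclideanSpace ℝ (Fin 4) → ℝ) ⊆ Metric.closedBall 0 ℓ ∧ ∀ z, |v j z| ≤ 1) ∧
        0 < a₀ ∧ ∀ a : ℝ, 0 < a → a ≤ a₀ → ∀ L : ℕ, Λ₅ ≤ a * L →
          κ * ℓ ^ p ≤ ∑ j,
            ((∫ ω, (∑ y ∈ box 4 L, v j (a • siteToE y) * densA y (cfgReflA ω)) *
                ∑ y ∈ box 4 L, v j (a • siteToE y) * densA y ω ∂μM) -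
              (∫ ω, ∑ y ∈ box 4 L, v j (a • siteToE y) * densA y ω ∂μM) ^ 2)) ∧
    ¬ ∃ (f g h : 𝓢(E4, ℝ)) (ε : ℝ), 0 < ε ∧ ε ≤ |8 * maxwellRing3 f g h| :=
  ⟨latticeMaxwell_finiteRankMirrorFloor, freeAbelian_NT_clauseII_false⟩

end Summit.QuantumFields.YangMills.Theorems.FiniteRankMirror.Rung

end
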